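import Mathlib
import Summits.Parity.GeneralizedHardyLittlewood.Theorems.ParityLeakOneFifthParityLeakSieveTypeIGrowth
import HarnessLib

/-!
# Route ParityLeakOneFifth, crux `ParityLeakSieve` (stmt-Parity-18381), skeleton `birth`:
# the Type-I comparison of stub S1 — the final arithmetic over real variables

`typeI_tail_arith`: the five smallness conditions (the `e^{−1/ε}` term, the `1/z, 1/y` terms, the
Bombieri–Vinogradov remainder, the trivial remainders `D·L·(ψ−ϑ)` and the term `D·(1 + … + L²/V)`)
assembled into `≤ δ x/log x`, with every analytic input supplied as a real-variable hypothesis.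
-/

namespace Summit.Parity.GeneralizedHardyLittlewood.Theorems.ParityLeakOneFifth

open Real

set_option maxHeartbeats 3200000 in
/-- The final arithmetic of the Type-I comparison, over real variables. -/
theorem typeI_tail_arith {x ℓ t z y D L V Vshw Vshz P1 E Φ₂ Δ nD nE BVs S₁ C₁ Cb CB c δ ε K : ℝ}
    (hx0 : 0 < x) (hℓ3 : 3 ≤ ℓ) (hℓ0 : 0 < ℓ) (hxℓ : x = Real.exp ℓ) (ht2 : 2 ≤ t) (ht0 : 0 < t) (htℓ : t ≤ ℓ)
    (hexpt : Real.exp t = ℓ) (hz' : z = Real.exp (t ^ 2)) (hz2 : 2 < z)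
    (hyexp : y = Real.exp (ℓ / 5)) (hy0 : 0 < y) (hDexp : D = Real.exp ((1 / 2 - 2 * ε) * ℓ)) (hD0 : 0 < D)
    (hLexp : L = Real.exp (ε * ℓ)) (hLpos : 0 < L)
    (hV0 : 0 < V) (hVc : c / t ^ 4 ≤ V) (hVshz1 : Vshz ≤ 1) (hP10 : 0 ≤ P1) (hP11 : P1 ≤ 1)
    (hVshwle : Vshw ≤ 2 / (ε ^ 2 * ℓ)) (hVzwle : Vshz * P1 ≤ 2 / (ε ^ 2 * ℓ))
    (hE0 : 0 ≤ E) (hE1 : E ≤ 1) (hE6 : E ≤ 6 * ε ^ 3)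
    (hΦ₂ : Φ₂ = 1 + Cb * (Vshz * P1) * E + L ^ 2 / V) (hΦ₂0 : 0 ≤ Φ₂)
    (hΔ0 : 0 ≤ Δ) (hΔle : Δ ≤ 4 * Real.exp (ℓ / 2) * (ℓ + 1))
    (hcardD : nD ≤ D) (hcardE : nE ≤ L) (hnE0 : 0 ≤ nE)
    (hBV : BVs ≤ CB * (2 * x) / ℓ ^ 3) (hCB0 : 0 ≤ CB) (hC₁ : 0 < C₁) (hCb : 0 < Cb) (hc : 0 < c)
    (hδ : 0 < δ) (hε : 0 < ε) (hε25 : ε ≤ 1 / 25) (hS₁0 : 0 < S₁)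
    (hK : K = 30 * S₁ * (4 * C₁ + 2 * Cb) + 1) (hK0 : 0 < K) (hεK : ε ≤ δ / K)
    (hL₂ℓ : ℓ ≤ δ / (60 * S₁) * Real.exp (1 / 5 * ℓ)) (hL₃ℓ : ℓ ≤ δ / (10 * (2 + Cb)) * Real.exp (1 / 2 * ℓ))
    (hL₄ℓ : ℓ ^ 5 ≤ c * δ / 10 * Real.exp (21 / 50 * ℓ)) (hL₅ℓ : ℓ ^ 2 ≤ δ / 30 * Real.exp (ε * ℓ))
    (hM2ℓ : 40 * S₁ / δ + 3 ≤ ℓ) (hM7ℓ : 20 * CB / δ + 1 ≤ ℓ) :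
    x * S₁ * (2 * C₁ * Vshw * E + 4 / z + 6 / y + Cb * (Vshz * P1) * E) + 2 * BVs + nD * (nE * Δ) + nD * Φ₂ ≤
      δ * x / ℓ := by
  obtain ⟨Φ₁, hΦ₁⟩ : ∃ v : ℝ, v = 2 * C₁ * Vshw * E + 4 / z + 6 / y + Cb * (Vshz * P1) * E := ⟨_, rfl⟩
  rw [← hΦ₁]
  -- the smallness conditions
  have hKε : 30 * S₁ * (4 * C₁ + 2 * Cb) * ε ≤ δ := by
    have h1 := (le_div_iff₀ hK0).1 hεK
    have h2 : 30 * S₁ * (4 * C₁ + 2 * Cb) * ε ≤ K * ε := by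
      have e : K * ε = 30 * S₁ * (4 * C₁ + 2 * Cb) * ε + ε := by rw [hK]; ring
      rw [e]; linarith only [hε]
    linarith only [h1, h2]
  have hA : S₁ * (2 * C₁ * Vshw * E + Cb * (Vshz * P1) * E) ≤ δ / (5 * ℓ) := by
    have hV1' : Vshw ≤ 2 / (ε ^ 2 * ℓ) := hVshwle
    have hV2' : Vshz * P1 ≤ 2 / (ε ^ 2 * ℓ) := hVzwle
    have hb : (2 / (ε ^ 2 * ℓ)) * E ≤ 12 * ε / ℓ := by
      calc 2 / (ε ^ 2 * ℓ) * E ≤ 2 / (ε ^ 2 * ℓ) * (6 * ε ^ 3) :=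
            mul_le_mul_of_nonneg_left hE6 (by positivity)
        _ = 12 * ε / ℓ := by field_simp; ring
    have t1 : Vshw * E ≤ 12 * ε / ℓ := (mul_le_mul_of_nonneg_right hV1' hE0).trans hb
    have t2 : (Vshz * P1) * E ≤ 12 * ε / ℓ := (mul_le_mul_of_nonneg_right hV2' hE0).trans hb
    have h1 : 2 * C₁ * Vshw * E + Cb * (Vshz * P1) * E ≤ (2 * C₁ + Cb) * (12 * ε / ℓ) := by
      have u1 := mul_le_mul_of_nonneg_left t1 (by positivity : 0 ≤ 2 * C₁)
      have u2 := mul_le_mul_of_nonneg_left t2 hCb.le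
      have e1 : 2 * C₁ * Vshw * E = 2 * C₁ * (Vshw * E) := by ring
      have e2 : Cb * (Vshz * P1) * E = Cb * (Vshz * P1 * E) := by ring
      rw [e1, e2]
      have e3 : (2 * C₁ + Cb) * (12 * ε / ℓ) = 2 * C₁ * (12 * ε / ℓ) + Cb * (12 * ε / ℓ) := by ring
      linarith only [u1, u2, e3]
    have h2 : S₁ * ((2 * C₁ + Cb) * (12 * ε / ℓ)) ≤ δ / (5 * ℓ) := by
      rw [show S₁ * ((2 * C₁ + Cb) * (12 * ε / ℓ)) = (30 * S₁ * (4 * C₁ + 2 * Cb) * ε) / (5 * ℓ) by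
        field_simp; ring]
      exact div_le_div_of_nonneg_right hKε (by positivity)
    exact (mul_le_mul_of_nonneg_left h1 hS₁0.le).trans h2
  have hB : S₁ * (4 / z + 6 / y) ≤ δ / (5 * ℓ) := by
    have hz_ge : ℓ ^ 2 ≤ z := by
      have e2 : ℓ ^ 2 = Real.exp (2 * t) := by
        rw [← hexpt, ← Real.exp_nat_mul]; norm_num
      rw [hz', e2]
      exact Real.exp_le_exp.2 (by nlinarith only [ht2])
    have hz0 : 0 < z := by linarith
    have h1 : 40 * S₁ * ℓ ≤ δ * z := by
      have hℓ' : 40 * S₁ / δ ≤ ℓ := by linarith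
      have h3 := (div_le_iff₀ hδ).1 hℓ'
      have h4 : δ * ℓ ^ 2 ≤ δ * z := mul_le_mul_of_nonneg_left hz_ge hδ.le
      have h5 : 40 * S₁ * ℓ ≤ ℓ * δ * ℓ := mul_le_mul_of_nonneg_right h3 hℓ0.le
      nlinarith only [h4, h5]
    have h2 : 60 * S₁ * ℓ ≤ δ * y := by
      have h := hL₂ℓ
      have ey : Real.exp (1 / 5 * ℓ) = y := by rw [hyexp]; ring_nf
      rw [ey] at h
      have h' := mul_le_mul_of_nonneg_left h (by positivity : (0 : ℝ) ≤ 60 * S₁)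
      have e' : 60 * S₁ * (δ / (60 * S₁) * y) = δ * y := by field_simp
      linarith only [h', e']
    have e1 : S₁ * (4 / z) ≤ δ / (10 * ℓ) := by
      rw [show S₁ * (4 / z) = (4 * S₁) / z by ring, div_le_div_iff₀ hz0 (by positivity)]
      linarith only [h1]
    have e2 : S₁ * (6 / y) ≤ δ / (10 * ℓ) := by
      rw [show S₁ * (6 / y) = (6 * S₁) / y by ring, div_le_div_iff₀ hy0 (by positivity)]
      linarith only [h2]
    have e3 : δ / (5 * ℓ) = δ / (10 * ℓ) + δ / (10 * ℓ) := by field_simp; ring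
    rw [mul_add, e3]; exact add_le_add e1 e2
  have hBVf : 2 * BVs ≤ δ / 5 * x / ℓ := by
    have hℓCB : 20 * CB ≤ δ * ℓ ^ 2 := by
      have h1 : 20 * CB / δ + 1 ≤ ℓ := hM7ℓ
      have h2 := (div_le_iff₀ hδ).1 (show 20 * CB / δ ≤ ℓ by linarith)
      nlinarith
    calc 2 * BVs ≤ 2 * (CB * (2 * x) / ℓ ^ 3) :=
          mul_le_mul_of_nonneg_left hBV (by norm_num)
      _ = (4 * CB * x) / ℓ ^ 3 := by ring
      _ ≤ δ / 5 * x / ℓ := by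
          rw [show δ / 5 * x / ℓ = (δ / 5 * x) / ℓ by ring,
            div_le_div_iff₀ (by positivity) hℓ0]
          have h6 := mul_le_mul_of_nonneg_left hℓCB (by positivity : 0 ≤ x * ℓ)
          have e6 : x * ℓ * (δ * ℓ ^ 2) = δ / 5 * x * ℓ ^ 3 * 5 := by ring
          have e7 : x * ℓ * (20 * CB) = 4 * CB * x * ℓ * 5 := by ring
          nlinarith only [h6, e6, e7]
  have hDL : nD * (nE * Δ) ≤ δ / 5 * x / ℓ := by
    have hEΔ0 : 0 ≤ nE * Δ := mul_nonneg hnE0 hΔ0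
    have h1 : nD * (nE * Δ) ≤ D * (L * (4 * Real.exp (ℓ / 2) * (ℓ + 1))) :=
      mul_le_mul hcardD (mul_le_mul hcardE hΔle hΔ0 hLpos.le) hEΔ0 hD0.le
    refine h1.trans ?_
    have hprod : D * L * Real.exp (ℓ / 2) = x * Real.exp (-(ε * ℓ)) := by
      rw [hDexp, hLexp, hxℓ, ← Real.exp_add, ← Real.exp_add, ← Real.exp_add]
      congr 1; ring
    have key : 20 * ℓ * (ℓ + 1) ≤ δ * Real.exp (ε * ℓ) := by
      have h := hL₅ℓ
      have e : δ / 30 * Real.exp (ε * ℓ) * 30 = δ * Real.exp (ε * ℓ) := by ring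
      have h20 : 20 * ℓ * (ℓ + 1) ≤ 30 * ℓ ^ 2 := by nlinarith only [hℓ3]
      nlinarith only [h, e, h20]
    have hexp0 : 0 < Real.exp (ε * ℓ) := Real.exp_pos _
    have e1 : D * (L * (4 * Real.exp (ℓ / 2) * (ℓ + 1))) = 4 * (ℓ + 1) * (D * L * Real.exp (ℓ / 2)) := by ring
    rw [e1, hprod, Real.exp_neg]
    rw [show 4 * (ℓ + 1) * (x * (Real.exp (ε * ℓ))⁻¹) = (20 * ℓ * (ℓ + 1) * x) / (5 * ℓ * Real.exp (ε * ℓ)) by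
      field_simp; ring]
    rw [show δ / 5 * x / ℓ = (δ * Real.exp (ε * ℓ) * x) / (5 * ℓ * Real.exp (ε * ℓ)) by
      field_simp]
    exact div_le_div_of_nonneg_right (mul_le_mul_of_nonneg_right key hx0.le) (by positivity)
  have hDΦ : nD * Φ₂ ≤ δ / 5 * x / ℓ := by
    have hΦ₂le : Φ₂ ≤ (1 + Cb) + L ^ 2 / V := by
      rw [hΦ₂]
      have h1 : (Vshz * P1) * E ≤ 1 := by
        calc (Vshz * P1) * E ≤ 1 * 1 := mul_le_mul (mul_le_one₀ hVshz1 hP10 hP11) hE1 hE0 zero_le_one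
          _ = 1 := one_mul _
      have h7 := mul_le_mul_of_nonneg_left h1 hCb.le
      linarith only [h7]
    have hDle : D ≤ Real.exp (ℓ / 2) := by
      rw [hDexp]; exact Real.exp_le_exp.2 (by nlinarith only [hε, hℓ0])
    have h1 : nD * Φ₂ ≤ Real.exp (ℓ / 2) * ((1 + Cb) + L ^ 2 / V) :=
      mul_le_mul (hcardD.trans hDle) hΦ₂le hΦ₂0 (Real.exp_pos _).le
    refine h1.trans ?_
    have hx2 : x = Real.exp (ℓ / 2) * Real.exp (ℓ / 2) := by rw [← Real.exp_add, hxℓ]; ring_nf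
    have p1 : Real.exp (ℓ / 2) * (1 + Cb) ≤ δ / 10 * x / ℓ := by
      have h := hL₃ℓ
      have h' : 10 * (2 + Cb) * ℓ ≤ δ * Real.exp (ℓ / 2) := by
        have := mul_le_mul_of_nonneg_left h (by positivity : (0 : ℝ) ≤ 10 * (2 + Cb))
        have e : 10 * (2 + Cb) * (δ / (10 * (2 + Cb)) * Real.exp (1 / 2 * ℓ)) = δ * Real.exp (1 / 2 * ℓ) := by
          field_simp
        rw [show (1 : ℝ) / 2 * ℓ = ℓ / 2 by ring] at this e
        linarith
      rw [hx2, show δ / 10 * (Real.exp (ℓ / 2) * Real.exp (ℓ / 2)) / ℓ =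
        Real.exp (ℓ / 2) * (δ * Real.exp (ℓ / 2) / (10 * ℓ)) by field_simp]
      refine mul_le_mul_of_nonneg_left ?_ (Real.exp_pos _).le
      rw [le_div_iff₀ (by positivity)]
      nlinarith only [h', hCb, hℓ0]
    have p2 : Real.exp (ℓ / 2) * (L ^ 2 / V) ≤ δ / 10 * x / ℓ := by
      have hVℓ : c / ℓ ^ 4 ≤ V := by
        refine le_trans ?_ hVc
        exact div_le_div_of_nonneg_left hc.le (by positivity) (pow_le_pow_left₀ ht0.le htℓ 4)
      have hL2 : L ^ 2 ≤ Real.exp (2 / 25 * ℓ) := by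
        rw [hLexp, ← Real.exp_nat_mul]
        exact Real.exp_le_exp.2 (by push_cast; nlinarith only [hε25, hℓ0])
      have h := hL₄ℓ
      have hq : L ^ 2 / V ≤ Real.exp (2 / 25 * ℓ) * ℓ ^ 4 / c := by
        rw [div_le_iff₀ hV0]
        have h3 : Real.exp (2 / 25 * ℓ) * ℓ ^ 4 / c * (c / ℓ ^ 4) ≤ Real.exp (2 / 25 * ℓ) * ℓ ^ 4 / c * V :=
          mul_le_mul_of_nonneg_left hVℓ (by positivity)
        have e : Real.exp (2 / 25 * ℓ) * ℓ ^ 4 / c * (c / ℓ ^ 4) = Real.exp (2 / 25 * ℓ) := by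
          field_simp
        linarith only [h3, e, hL2]
      calc Real.exp (ℓ / 2) * (L ^ 2 / V) ≤ Real.exp (ℓ / 2) * (Real.exp (2 / 25 * ℓ) * ℓ ^ 4 / c) :=
            mul_le_mul_of_nonneg_left hq (Real.exp_pos _).le
        _ = Real.exp ((29 / 50) * ℓ) * ℓ ^ 4 / c := by
            rw [mul_div_assoc', ← mul_assoc, ← Real.exp_add]; congr 2; ring
        _ ≤ δ / 10 * x / ℓ := by
            rw [hxℓ, div_le_div_iff₀ hc hℓ0]
            have e : Real.exp ℓ = Real.exp ((29 / 50) * ℓ) * Real.exp ((21 / 50) * ℓ) := by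
              rw [← Real.exp_add]; ring_nf
            rw [e]
            have hpos := Real.exp_pos ((29 / 50) * ℓ)
            have h' : ℓ ^ 4 * ℓ ≤ c * δ / 10 * Real.exp ((21 / 50) * ℓ) := by
              rw [← pow_succ]; exact h
            have h'' := mul_le_mul_of_nonneg_left h' hpos.le
            nlinarith only [h'', Real.exp_pos ((21/50) * ℓ), hpos]
    have e : δ / 5 * x / ℓ = δ / 10 * x / ℓ + δ / 10 * x / ℓ := by ring
    rw [mul_add, e]; exact add_le_add p1 p2
  have hΦ₁eq : Φ₁ = (2 * C₁ * Vshw * E + Cb * (Vshz * P1) * E) + (4 / z + 6 / y) := by rw [hΦ₁]; ring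
  exact typeI_final_arith le_rfl hΦ₁eq hA hB hBVf hDL hDΦ hx0 hℓ0

end Summit.Parity.GeneralizedHardyLittlewood.Theorems.ParityLeakOneFifth
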